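import Summits.BirchSwinnertonDyer.Rank1Residual.GaloisImage.LagrangianComplementDichotomy
import Mathlib.LinearAlgebra.Dimension.Free
import Mathlib.Tactic.LinearCombination
import Mathlib.Tactic.Ring
import Mathlib.Tactic.Abel
import Mathlib.Tactic.FinCases
import HarnessLib

/-!
# The three-Lagrangian lemma, I (PART B of T-K43-TOOL): graphs over a Lagrangian complement, the
# "`Alt²` of a plane is a line" engine, and `d = 1` is impossible
# (cell `b2b-bsdres`, team n1011, seat p02 gen 9 — TOOL file; row T-K43-TOOL = r1 ROUTE-1 §43.1
# LEMMA 43.1 (a) typed once + the records-facing `finrank_inf_ne_one`; PART A = the dichotomy (c) is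
# p12's `LagrangianComplementDichotomy.lean` (p311626), CONSUMED BY NAME here — lead R5-86 (l) +
# ADDENDUM 00:31Z; skeleton `cells/n1011/skel/T-K43.md`; referee-1 ACK-1 GEN 36)

HONEST FRAMING (cell `b2b-bsdres`, run/shared/lean/b2b/bsd-rank1-residual/, verbatim in every
file): the goal of the cell is to DELETE the COMBINATION-SHAPED residual classes of the
Birch–Swinnerton-Dyer formula for ALL analytic-rank `≤ 1` elliptic curves over `ℚ` — "full BSD
formula for every rank `≤ 1` curve in class `C`" assembled STRICTLY from published theorems — so
that the rank-`≤ 1` remainder becomes exactly the CONSTRUCTION-SHAPED classes, which are TYPED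
(missing-input `Prop`s), NOT attempted. This is not "finishing BSD". Team n1011 (N10 / N11, the
additive block `X4 ∧ p = 3`): research route; no claim beyond the stated classes; labels UNCHANGED;
nothing is booked. Theorems only (no definition, no named fact); a TOOL file of pure linear algebra:
nothing here is a class theorem, and nothing here is cohomological — the cohomological reading
(`H = H¹(ℚ₃, E[3])` with the Tate local-duality pairing, `W = ι_* H¹(ℚ₃, ⟨T⟩)`, `L = im κ₃`) is the
business of the wrapper file `ThreeLagrangianLocalConditions.lean`, where the three cohomological
inputs are DISPLAYED BINDERS.

## Setting (the currency of PART A, `LagrangianComplementDichotomy.lean`)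

`K` a field with `[NeZero (2 : K)]`, `V` a `K`-space, `B : LinearMap.BilinForm K V` with
`hB : B.Nondegenerate`, `hBs : B.IsSymm` where needed. A subspace `L` is *isotropic* when
`∀ x ∈ L, ∀ y ∈ L, B x y = 0`. For `Λ₀, W ≤ V` and a linear `g : Λ₀ →ₗ W` the GRAPH of `g` is
written inline as `LinearMap.range (Λ₀.subtype + W.subtype ∘ₗ g) = {x + g x : x ∈ Λ₀}` (no
definition is introduced).

## What this file proves (r1 ROUTE-1 §43.1, LEMMA 43.1 (a); (c) is PART A, by name)

* §1 (a) `isotropic_range_graph_iff_skew`, `skew_iff_alternating` — for `Λ₀, W` isotropic the graph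
  `Γ_g` is isotropic iff `B_g(x, y) := B x (g y)` is skew on `Λ₀`, iff (as `2 ≠ 0`) it is
  alternating; `range_graph_inf_eq_bot`, `finrank_range_graph` — `Γ_g` is a plane transverse to
  `W`; `existsUnique_graph_range_eq` — conversely every `Λ` with `Λ ⊓ W = ⊥` and `dim Λ = dim Λ₀`
  is `Γ_g` for a UNIQUE `g` (when `Λ₀ ⊕ W = V`). These parametrise the transverse planes and are
  what the COUNT (file II, `ThreeLagrangianCount.lean`, LEMMA 43.1 (b)) runs on.
* §2 the engine `graph_eq_zero_of_skew_of_apply_basis_eq_zero` — `Λ₀ ⊕ W = V`, `W` isotropic: a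
  skew `g` with `B (b 0) (g (b 1)) = 0` for a basis `b` of the plane `Λ₀` is `0` (so `g ↦ B b₀ (g b₁)`
  is injective on skew graph maps: "`Alt²` of a plane is a line").
* §3 **`finrank_inf_ne_one`** — `d = 1` is impossible: in a non-degenerate symmetric `4`-space two
  isotropic `2`-planes transverse to an isotropic `2`-plane `W` never meet in a line — a one-line
  consequence of PART A's `LagrangianDichotomy.eq_or_inf_eq_bot_of_finrank_eq_four` (p12,
  p311626), consumed BY NAME; no second proof of the dichotomy is given here.

presearch: "Lagrangians transverse to a fixed Lagrangian ↔ alternating forms on it" is textbook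
linear algebra (the big cell of the Lagrangian / orthogonal Grassmannian); no Mathlib lemma states
it (`lean search 'Lagrangian|isotropic' --decl`: Weil-type / Kuga–Satake files only); r1 ROUTE-1
§43.6 (n1) records the corpus + galaxy queries. Proved here from scratch; nothing is cited.
-/

open Module Submodule

namespace Summit.BirchSwinnertonDyer.Rank1Residual.GaloisImage.ThreeLagrangian

variable {K V : Type*} [Field K] [AddCommGroup V] [Module K V]

/-! ## §1 (a) Graphs over a Lagrangian complement -/

section Graph

variable (B : LinearMap.BilinForm K V) {Λ₀ W : Submodule K V}

/-- Membership in the graph `Γ_g = range (ι_{Λ₀} + ι_W ∘ g)`: `u ∈ Γ_g ↔ ∃ x : Λ₀, x + g x = u`.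
[folklore] -/
theorem mem_range_graph_iff (g : Λ₀ →ₗ[K] W) (u : V) :
    u ∈ LinearMap.range (Λ₀.subtype + W.subtype ∘ₗ g) ↔ ∃ x : Λ₀, (x : V) + (g x : V) = u := by
  simp only [LinearMap.mem_range, LinearMap.add_apply, LinearMap.coe_comp, Function.comp_apply,
    Submodule.coe_subtype]

/-- **LEMMA 43.1 (a), second half.** For `Λ₀, W` isotropic and `B` symmetric, the graph `Γ_g` of
`g : Λ₀ →ₗ W` is isotropic iff `B_g(x, y) := B x (g y)` is SKEW on `Λ₀`:
`B (x + g x) (y + g y) = B x (g y) + B y (g x)`. [folklore] -/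
theorem isotropic_range_graph_iff_skew (hBs : B.IsSymm)
    (hΛ₀ : ∀ x ∈ Λ₀, ∀ y ∈ Λ₀, B x y = 0) (hW : ∀ x ∈ W, ∀ y ∈ W, B x y = 0) (g : Λ₀ →ₗ[K] W) :
    (∀ u ∈ LinearMap.range (Λ₀.subtype + W.subtype ∘ₗ g),
      ∀ v ∈ LinearMap.range (Λ₀.subtype + W.subtype ∘ₗ g), B u v = 0) ↔
    ∀ x y : Λ₀, B (x : V) (g y : V) + B (y : V) (g x : V) = 0 := by
  have key : ∀ x y : Λ₀, B ((x : V) + (g x : V)) ((y : V) + (g y : V)) =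
      B (x : V) (g y : V) + B (y : V) (g x : V) := fun x y ↦ by
    simp only [map_add, LinearMap.add_apply]
    rw [hΛ₀ _ x.2 _ y.2, hW _ (g x).2 _ (g y).2, hBs.eq (g x : V) (y : V)]
    abel
  constructor
  · intro h x y
    rw [← key]
    exact h _ ((mem_range_graph_iff g _).mpr ⟨x, rfl⟩) _ ((mem_range_graph_iff g _).mpr ⟨y, rfl⟩)
  · intro h u hu v hv
    obtain ⟨x, rfl⟩ := (mem_range_graph_iff g u).mp hu
    obtain ⟨y, rfl⟩ := (mem_range_graph_iff g v).mp hv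
    rw [key, h]

/-- Skew `⟺` alternating for `B_g` when `2 ≠ 0` in `K` (polarisation). [folklore] -/
theorem skew_iff_alternating [NeZero (2 : K)] (g : Λ₀ →ₗ[K] W) :
    (∀ x y : Λ₀, B (x : V) (g y : V) + B (y : V) (g x : V) = 0) ↔
      ∀ x : Λ₀, B (x : V) (g x : V) = 0 := by
  constructor
  · intro h x
    have hx := h x x
    rw [← two_mul] at hx
    exact (mul_eq_zero.mp hx).resolve_left (NeZero.ne 2)
  · intro h x y
    have hxy := h (x + y)
    simp only [map_add, Submodule.coe_add, LinearMap.add_apply] at hxy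
    linear_combination hxy - h x - h y

/-- The graph of `g : Λ₀ →ₗ W` is transverse to `W` as soon as `Λ₀` is. [folklore] -/
theorem range_graph_inf_eq_bot (hd : Λ₀ ⊓ W = ⊥) (g : Λ₀ →ₗ[K] W) :
    LinearMap.range (Λ₀.subtype + W.subtype ∘ₗ g) ⊓ W = ⊥ := by
  rw [eq_bot_iff]
  rintro u ⟨hu, huW⟩
  obtain ⟨x, rfl⟩ := (mem_range_graph_iff g u).mp hu
  have hxW : (x : V) ∈ W := by
    have : (x : V) = ((x : V) + (g x : V)) - (g x : V) := by abel
    rw [this]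
    exact W.sub_mem huW (g x).2
  have hx0 : (x : V) = 0 := by
    have hmem : (x : V) ∈ Λ₀ ⊓ W := ⟨x.2, hxW⟩
    rw [hd] at hmem
    exact (Submodule.mem_bot K).mp hmem
  have hx : x = 0 := by exact_mod_cast hx0
  rw [Submodule.mem_bot, hx, map_zero, Submodule.coe_zero, Submodule.coe_zero, add_zero]

/-- The map `x ↦ x + g x` is injective when `Λ₀ ⊓ W = ⊥`, so `dim Γ_g = dim Λ₀`. [folklore] -/
theorem finrank_range_graph (hd : Λ₀ ⊓ W = ⊥) (g : Λ₀ →ₗ[K] W) :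
    finrank K (LinearMap.range (Λ₀.subtype + W.subtype ∘ₗ g)) = finrank K Λ₀ := by
  apply LinearMap.finrank_range_of_inj
  intro x y hxy
  simp only [LinearMap.add_apply, LinearMap.coe_comp, Function.comp_apply,
    Submodule.coe_subtype] at hxy
  have hmem : ((x - y : Λ₀) : V) ∈ Λ₀ ⊓ W := by
    refine ⟨(x - y).2, ?_⟩
    have : ((x - y : Λ₀) : V) = (g y : V) - (g x : V) := by
      rw [Submodule.coe_sub, sub_eq_sub_iff_add_eq_add, hxy, add_comm]
    rw [this]
    exact W.sub_mem (g y).2 (g x).2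
  rw [hd, Submodule.mem_bot] at hmem
  have : x - y = 0 := by exact_mod_cast hmem
  exact sub_eq_zero.mp this

/-- **LEMMA 43.1 (a), first half.** If `Λ₀ ⊕ W = V`, every subspace `Λ` with `Λ ⊓ W = ⊥` and
`dim Λ = dim Λ₀` is the graph `Γ_g` of a UNIQUE linear `g : Λ₀ →ₗ W` (namely
`g = π_W ∘ (π_{Λ₀}|_Λ)⁻¹`, the projections being those of the decomposition `V = Λ₀ ⊕ W`).
[folklore] -/
theorem existsUnique_graph_range_eq [FiniteDimensional K V] (hc : IsCompl Λ₀ W)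
    (Λ : Submodule K V) (hΛW : Λ ⊓ W = ⊥) (hΛ : finrank K Λ = finrank K Λ₀) :
    ∃! g : Λ₀ →ₗ[K] W, LinearMap.range (Λ₀.subtype + W.subtype ∘ₗ g) = Λ := by
  -- `e₀ = π_{Λ₀}|_Λ : Λ → Λ₀` is injective (kernel `Λ ∩ W = 0`), hence bijective by dimension
  set e₀ : Λ →ₗ[K] Λ₀ := (Λ₀.projectionOnto W hc) ∘ₗ Λ.subtype with he₀
  have he₀inj : Function.Injective e₀ := by
    intro y y' hyy'
    have h0 : e₀ (y - y') = 0 := by rw [map_sub, hyy', sub_self]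
    rw [he₀, LinearMap.comp_apply, Submodule.subtype_apply,
      Submodule.projectionOnto_apply_eq_zero_iff] at h0
    have hmem : ((y - y' : Λ) : V) ∈ Λ ⊓ W := ⟨(y - y').2, h0⟩
    rw [hΛW, Submodule.mem_bot] at hmem
    have : y - y' = 0 := by exact_mod_cast hmem
    exact sub_eq_zero.mp this
  have he₀surj : Function.Surjective e₀ :=
    (LinearMap.injective_iff_surjective_of_finrank_eq_finrank hΛ).mp he₀inj
  let e : Λ ≃ₗ[K] Λ₀ := LinearEquiv.ofBijective e₀ ⟨he₀inj, he₀surj⟩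
  have he : ∀ y : Λ, ((e y : Λ₀) : V) = Λ₀.projection W hc (y : V) := fun y ↦ rfl
  -- the graph map
  let g : Λ₀ →ₗ[K] W := (W.projectionOnto Λ₀ hc.symm) ∘ₗ Λ.subtype ∘ₗ (e.symm : Λ₀ →ₗ[K] Λ)
  have hg : ∀ x : Λ₀, (g x : V) = W.projection Λ₀ hc.symm ((e.symm x : Λ) : V) := fun x ↦ rfl
  have hsum : ∀ x : Λ₀, (x : V) + (g x : V) = ((e.symm x : Λ) : V) := fun x ↦ by
    have hx : (x : V) = Λ₀.projection W hc ((e.symm x : Λ) : V) := by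
      rw [← he, e.apply_symm_apply]
    rw [hx, hg, Submodule.projection_add_projection_eq_self]
  refine ⟨g, ?_, fun g' hg' ↦ ?_⟩
  · ext u
    rw [mem_range_graph_iff]
    constructor
    · rintro ⟨x, rfl⟩
      rw [hsum]
      exact (e.symm x).2
    · intro hu
      exact ⟨e ⟨u, hu⟩, by rw [hsum, e.symm_apply_apply]⟩
  · ext x
    -- `x + g' x ∈ Λ` and `x + g x ∈ Λ`, so `g' x - g x ∈ Λ ∩ W = 0`
    have h1 : (x : V) + (g' x : V) ∈ Λ := hg' ▸ (mem_range_graph_iff g' _).mpr ⟨x, rfl⟩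
    have h2 : (x : V) + (g x : V) ∈ Λ := by rw [hsum]; exact (e.symm x).2
    have hmem : ((g' x - g x : W) : V) ∈ Λ ⊓ W := by
      refine ⟨?_, (g' x - g x).2⟩
      have : ((g' x - g x : W) : V) = ((x : V) + (g' x : V)) - ((x : V) + (g x : V)) := by
        rw [Submodule.coe_sub]; abel
      rw [this]
      exact Λ.sub_mem h1 h2
    rw [hΛW, Submodule.mem_bot] at hmem
    have : g' x - g x = 0 := by exact_mod_cast hmem
    exact congrArg Subtype.val (sub_eq_zero.mp this)

end Graph

/-! ## §2 The engine: a skew graph map with a vanishing entry vanishes -/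

section Engine

variable (B : LinearMap.BilinForm K V) {Λ₀ W : Submodule K V}

/-- For `V = Λ₀ ⊕ W` with `W` isotropic and `w ∈ W`: if `B x w = 0` for all `x ∈ Λ₀` then
`B v w = 0` for all `v`. [folklore] -/
theorem forall_apply_eq_zero_of_forall_mem (hc : IsCompl Λ₀ W) (hW : ∀ x ∈ W, ∀ y ∈ W, B x y = 0)
    {w : V} (hw : w ∈ W) (h : ∀ x ∈ Λ₀, B x w = 0) (v : V) : B v w = 0 := by
  rw [← Submodule.projection_add_projection_eq_self hc v, map_add, LinearMap.add_apply,
    h _ (Submodule.projection_apply_mem hc v), hW _ (Submodule.projection_apply_mem hc.symm v) _ hw,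
    add_zero]

/-- **Engine ("`Alt²` of a plane is a line").** `Λ₀ ⊕ W = V`, `W` isotropic, `B` non-degenerate,
`b` a basis of the plane `Λ₀` indexed by `Fin 2`, `2 ≠ 0`: a `g : Λ₀ →ₗ W` with `B_g` skew and
`B (b 0) (g (b 1)) = 0` is zero (all four matrix entries of `B_g` vanish, so each `g (b j)` is
orthogonal to `Λ₀` and to `W`, hence to `V`). [folklore] -/
theorem graph_eq_zero_of_skew_of_apply_basis_eq_zero [NeZero (2 : K)] (hB : B.Nondegenerate)
    (hc : IsCompl Λ₀ W) (hW : ∀ x ∈ W, ∀ y ∈ W, B x y = 0) (b : Basis (Fin 2) K Λ₀)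
    (g : Λ₀ →ₗ[K] W) (hskew : ∀ x y : Λ₀, B (x : V) (g y : V) + B (y : V) (g x : V) = 0)
    (h01 : B (b 0 : V) (g (b 1) : V) = 0) : g = 0 := by
  have halt := (skew_iff_alternating B g).mp hskew
  -- all matrix entries vanish
  have hentry : ∀ i j : Fin 2, B (b i : V) (g (b j) : V) = 0 := by
    intro i j
    fin_cases i <;> fin_cases j
    · exact halt (b 0)
    · exact h01
    · have := hskew (b 0) (b 1)
      rw [h01, zero_add] at this
      exact this
    · exact halt (b 1)
  -- hence each `g (b j)` is orthogonal to `Λ₀`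
  have horth : ∀ j : Fin 2, ∀ x ∈ Λ₀, B x (g (b j) : V) = 0 := by
    intro j x hx
    -- the functional `x ↦ B x (g (b j))` on `Λ₀` vanishes on the basis
    have hfun : (LinearMap.flip B (g (b j) : V)) ∘ₗ Λ₀.subtype = 0 := by
      refine b.ext fun i ↦ ?_
      rw [LinearMap.comp_apply, Submodule.subtype_apply, LinearMap.flip_apply, LinearMap.zero_apply]
      exact hentry i j
    have := LinearMap.congr_fun hfun ⟨x, hx⟩
    rwa [LinearMap.comp_apply, Submodule.subtype_apply, LinearMap.flip_apply,
      LinearMap.zero_apply] at this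
  -- hence to all of `V`, hence zero (right non-degeneracy)
  have hzero : ∀ j : Fin 2, g (b j) = 0 := by
    intro j
    have : (g (b j) : V) = 0 :=
      hB.2 _ (forall_apply_eq_zero_of_forall_mem B hc hW (g (b j)).2 (horth j))
    exact_mod_cast this
  exact b.ext fun j ↦ by rw [hzero j, LinearMap.zero_apply]

end Engine

/-! ## §3 `d = 1` is impossible (PART A's dichotomy, by name) -/

section Dichotomy

variable (B : LinearMap.BilinForm K V) {W L₁ L₂ : Submodule K V}

/-- **`d = 1` is impossible**: over a field with `2 ≠ 0`, in a `4`-space with a symmetric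
non-degenerate bilinear form, two isotropic `2`-planes `L₁, L₂` transverse to an isotropic `2`-plane
`W` never meet in a line: `dim (L₁ ⊓ L₂) ≠ 1` (r1 ROUTE-1 §43.1: "`d₃ = 1` is impossible"). From
PART A `LagrangianDichotomy.eq_or_inf_eq_bot_of_finrank_eq_four` (p12, p311626: `L₁ = L₂` or
`L₁ ⊓ L₂ = ⊥`). [folklore] -/
theorem finrank_inf_ne_one [NeZero (2 : K)] (hB : B.Nondegenerate) (hBs : B.IsSymm)
    (h4 : finrank K V = 4) (hW2 : finrank K W = 2) (hL₁2 : finrank K L₁ = 2)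
    (hL₂2 : finrank K L₂ = 2) (hW : ∀ x ∈ W, ∀ y ∈ W, B x y = 0)
    (hL₁ : ∀ x ∈ L₁, ∀ y ∈ L₁, B x y = 0) (hL₂ : ∀ x ∈ L₂, ∀ y ∈ L₂, B x y = 0)
    (hL₁W : L₁ ⊓ W = ⊥) (hL₂W : L₂ ⊓ W = ⊥) :
    finrank K ↥(L₁ ⊓ L₂) ≠ 1 := by
  haveI : FiniteDimensional K V := Module.finite_of_finrank_eq_succ h4
  rcases LagrangianDichotomy.eq_or_inf_eq_bot_of_finrank_eq_four B hB hBs h4 hW hL₁ hL₂ hW2 hL₁2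
    hL₂2 hL₁W hL₂W with h | h
  · rw [← h, inf_idem, hL₁2]; decide
  · rw [h, finrank_bot]; decide

end Dichotomy

end Summit.BirchSwinnertonDyer.Rank1Residual.GaloisImage.ThreeLagrangian
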